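import Mathlib
import Summits.Ventures.PercRepro2.HCov
import Summits.Ventures.PercRepro2.EdgeCubic
import Summits.Ventures.PercRepro2.EdgeCubicAll
import Summits.Ventures.PercRepro2.CPolarA3
import Summits.Ventures.PercRepro2.CPolarA3Marks
import Summits.Ventures.PercRepro2.PendantA3Pins
import Summits.Ventures.PercRepro2.PendantClusterPins
import Summits.Ventures.PercRepro2.PendantClusterMasses
import Summits.Ventures.PercRepro2.PendantClusterBern
import Summits.Ventures.PercRepro2.CPolarSub
import Summits.Ventures.PercRepro2.CPolarSubClasses

/-!
# THE STRENGTHENED COVARIANCE FORM (HCOV⁺) AND THE PENDANT FACE OF (SUB)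
(blind cell PercRepro2, p5 g16; `proofs/P5-OEDGE.md` §21)

`HCovPlus p ends o a₁ a₂ a₃ b` := `0 ≤ Q·Gc + (Qo·D − Q·Do)·(Q·EQb3 + gap·EQ3 + Q·PDb − D·Qb)` — in
normalised terms `α·G + Cov_ν(U_o, U_{a₃})·σ(b, a₃) ≥ 0` with `σ(b, a₃) = 2[S(bL, a₃H) + S(bH, a₃L)] ≥ 0`
the `(b, a₃)` cross-cluster BHK slack (`PendantA3.slack_nonneg`). It is (HCOV) with a penalty for a
negative union-cluster covariance between `o` and `a₃`: weaker than (HCOV) where `Cov ≥ 0`, stronger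
where `Cov < 0` (the cell's NEG instances); it is p2 g13's (PM⁺) read at the identified instance.

At the single fractional boundary edge `f = {z, u}` of a mark-free pendant `a₃`-cluster the landed
identities `D·(Q²·B1 − (Q² + QD)·Gc₀) = Q²·(Q·Gc₁ + cov·slack)` and
`D·(Q²·B2 − QD·Gc₀) = Q²D·Gc₁ + Q²·(Q·Gc₁ + cov·slack)` (CPolarSubClasses.lean) say exactly:

* **`sub1_pendant_iff_hcovPlus`**: `Sub1` at `f` ⟺ `HCovPlus` at the identified instance `(o, a₁, a₂, u, b)`
  (no positive-association hypothesis);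
* **`sub_of_pendant_of_hcovPlus`**: `HCovPlus` at `(o, a₁, a₂, u, b)` and (HCOV) at the open pin give
  `Sub1 ∧ Sub2` at `f` — so **`HCovPlus_all`** closes the whole pendant face of `CPolarA3Sub_all`
  (PA and NEG attachments alike), and the open hypothesis of the road is `HCovPlus_all` together
  with (SUB) at the non-pendant `a₃`-edges.
-/

namespace Summit.Ventures.PercRepro2

open UnionCluster CovForm CovForm.CPolarA3 PendantA3 PendantCluster CPolarSub CPolarSubClasses

namespace CPolarSubPlus

open EdgeLine

section Defs

variable {V : Type*} {E : Type*} [Fintype E] [DecidableEq E] {R : Type*} [Field R]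
  [LinearOrder R]

/-- The cleared union-cluster covariance `Q²·Cov_ν(U_o, U_v) = Qo·D_v − Q·Do_v`. -/
noncomputable def covU (p : E → R) (ends : E → Sym2 V) (o a₁ a₂ v : V) : R :=
  (prob p (avoidAll ends a₂ {a₁} ∩ connEvent ends a₁ o) +
      prob p (avoidAll ends a₂ {a₁} ∩ connEvent ends a₂ o)) * prob p (PDEvent ends a₁ a₂ v) -
    prob p (avoidAll ends a₂ {a₁}) * Do p ends o a₁ a₂ v

/-- The cleared `(b, v)` cross-cluster slack `Ŝ − D_v·Qb` (`= 2[S(bL, vH) + S(bH, vL)] ≥ 0`,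
`PendantA3.slack_nonneg`). -/
noncomputable def slackB (p : E → R) (ends : E → Sym2 V) (a₁ a₂ v b : V) : R :=
  prob p (avoidAll ends a₂ {a₁}) * EQb3 p ends a₁ a₂ v b + gap p ends a₁ a₂ b * EQ3 p ends a₁ a₂ v +
    prob p (avoidAll ends a₂ {a₁}) * PDb p ends a₁ a₂ v b -
    prob p (PDEvent ends a₁ a₂ v) *
      (prob p (avoidAll ends a₂ {a₁} ∩ connEvent ends a₁ b) +
        prob p (avoidAll ends a₂ {a₁} ∩ connEvent ends a₂ b))

/-- **(HCOV⁺)**: `0 ≤ Q·Gc + covU·slackB` — the covariance form with the negative-covariance penalty. -/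
def HCovPlus (p : E → R) (ends : E → Sym2 V) (o a₁ a₂ a₃ b : V) : Prop :=
  0 ≤ prob p (avoidAll ends a₂ {a₁}) * Gc p ends o a₁ a₂ a₃ b +
    covU p ends o a₁ a₂ a₃ * slackB p ends a₁ a₂ a₃ b

end Defs

section Closure

variable (R : Type*) [Field R] [LinearOrder R] [IsStrictOrderedRing R]

/-- **(HCOV⁺) for every finite graph** (five distinct marks). -/
def HCovPlus_all : Prop :=
  ∀ (V E : Type) [Fintype V] [DecidableEq V] [Fintype E] [DecidableEq E]
    (ends : E → Sym2 V) (p : E → R), IsProbVec p →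
    ∀ o a₁ a₂ a₃ b : V, a₁ ≠ a₂ → a₁ ≠ a₃ → a₂ ≠ a₃ → o ≠ a₁ → o ≠ a₂ → o ≠ a₃ → o ≠ b →
      b ≠ a₁ → b ≠ a₂ → b ≠ a₃ → HCovPlus p ends o a₁ a₂ a₃ b

end Closure

/-! ## The pendant face -/

section Pendant

variable {V : Type*} {E : Type*} [Fintype V] [DecidableEq V] [Fintype E] [DecidableEq E]
  {R : Type*} [Field R] [LinearOrder R] [IsStrictOrderedRing R]

variable {p : E → R} {ends : E → Sym2 V} {f : E} {o a₁ a₂ a₃ b z u : V}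

omit [Fintype V] [DecidableEq V] [Fintype E] [DecidableEq E] [LinearOrder R] [IsStrictOrderedRing R] in
/-- `sub1Poly_pendant` with the right-hand side grouped as `Q²·(Q·Gc₁ + cov·slack)` (pure `ring`). -/
lemma sub1Poly_pendant' (Q gap EQbo EQo Qo Qb Qbo D Do EQb3 EQb3o EQ3 EQ3o PDb PDbo : R) :
    D * (Q * Q * B1Poly Q Q Qo EQbo 0 0 EQo 0 0 Qb Qbo gap
        Q D Do EQbo EQb3 EQb3o EQo EQ3 EQ3o PDb PDbo gap -
      (Q * Q + Q * D) * GcPoly Q Q Qo EQbo 0 0 EQo 0 0 Qb Qbo gap) =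
    Q * Q * (Q * GcPoly Q D Do EQbo EQb3 EQb3o EQo EQ3 EQ3o PDb PDbo gap +
      (Qo * D - Q * Do) * (Q * EQb3 + gap * EQ3 + Q * PDb - D * Qb)) := by
  unfold B1Poly GcPoly polar1
  ring

omit [Fintype V] [DecidableEq V] [Fintype E] [DecidableEq E] [LinearOrder R] [IsStrictOrderedRing R] in
/-- `sub2Poly_pendant` with the right-hand side grouped as `Q²D·Gc₁ + Q²·(Q·Gc₁ + cov·slack)` (pure `ring`). -/
lemma sub2Poly_pendant' (Q gap EQbo EQo Qo Qb Qbo D Do EQb3 EQb3o EQ3 EQ3o PDb PDbo : R) :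
    D * (Q * Q * B2Poly Q Q Qo EQbo 0 0 EQo 0 0 Qb Qbo gap
        Q D Do EQbo EQb3 EQb3o EQo EQ3 EQ3o PDb PDbo gap -
      Q * D * GcPoly Q Q Qo EQbo 0 0 EQo 0 0 Qb Qbo gap) =
    Q * Q * D * GcPoly Q D Do EQbo EQb3 EQb3o EQo EQ3 EQ3o PDb PDbo gap +
      Q * Q * (Q * GcPoly Q D Do EQbo EQb3 EQb3o EQo EQ3 EQ3o PDb PDbo gap +
        (Qo * D - Q * Do) * (Q * EQb3 + gap * EQ3 + Q * PDb - D * Qb)) := by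
  unfold B2Poly GcPoly polar2
  ring

omit [Fintype V] [DecidableEq V] in
/-- **`Sub1` at a pendant edge ⟺ (HCOV⁺) at the identified instance**: after the pins collapse,
`D·(Q²·B1 − (Q² + QD)·Gc₀) = Q²·(Q·Gc₁ + covU·slackB)`. -/
theorem sub1_pendant_iff_hcovPlus (hK : ∀ e ∈ fracEdges p, TouchesReach p ends a₃ e → e = f)
    (hf : ends f = s(z, u)) (hz : z ∈ pinnedReach p ends a₃) (hu : u ∉ pinnedReach p ends a₃)
    (hf1 : p f ≠ 1) (h1 : a₁ ∉ pinnedReach p ends a₃) (h2 : a₂ ∉ pinnedReach p ends a₃)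
    (ho : o ∉ pinnedReach p ends a₃) (hb : b ∉ pinnedReach p ends a₃)
    (hD : 0 < prob p (PDEvent ends a₁ a₂ u)) (hQ : 0 < prob p (avoidAll ends a₂ {a₁})) :
    Sub1 p ends o a₁ a₂ a₃ b f ↔ HCovPlus p ends o a₁ a₂ u b := by
  obtain ⟨hQ0, hD0, hDo0, hEQbo0, hEQb3_0, hEQb3o0, hEQo0, hEQ3_0, hEQ3o0, hPDb0, hPDbo0, hgap0⟩ :=
    pins_zero_cluster p hK hf hz hu hf1 h1 h2 ho hb
  obtain ⟨hQ1, hD1, hDo1, hEQbo1, hEQb3_1, hEQb3o1, hEQo1, hEQ3_1, hEQ3o1, hPDb1, hPDbo1, hgap1⟩ :=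
    pins_one_cluster p hK hf hz hu hf1 h1 h2 ho hb
  unfold Sub1 HCovPlus covU slackB
  rw [Gc_eq_GcPoly, Gc_eq_GcPoly p ends o a₁ a₂ u b]
  unfold B1
  rw [hQ0, hD0, hDo0, hEQbo0, hEQb3_0, hEQb3o0, hEQo0, hEQ3_0, hEQ3o0, hPDb0, hPDbo0, hgap0,
    hQ1, hD1, hDo1, hEQbo1, hEQb3_1, hEQb3o1, hEQo1, hEQ3_1, hEQ3o1, hPDb1, hPDbo1, hgap1]
  have key := sub1Poly_pendant' (prob p (avoidAll ends a₂ {a₁})) (gap p ends a₁ a₂ b)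
    (EQbo p ends o a₁ a₂ b) (EQo p ends o a₁ a₂)
    (prob p (avoidAll ends a₂ {a₁} ∩ connEvent ends a₁ o) +
      prob p (avoidAll ends a₂ {a₁} ∩ connEvent ends a₂ o))
    (prob p (avoidAll ends a₂ {a₁} ∩ connEvent ends a₁ b) +
      prob p (avoidAll ends a₂ {a₁} ∩ connEvent ends a₂ b))
    (prob p (avoidAll ends a₂ {a₁} ∩ (connEvent ends a₁ o ∩ connEvent ends a₁ b)) +
      prob p (avoidAll ends a₂ {a₁} ∩ (connEvent ends a₂ o ∩ connEvent ends a₁ b)) +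
      prob p (avoidAll ends a₂ {a₁} ∩ (connEvent ends a₁ o ∩ connEvent ends a₂ b)) +
      prob p (avoidAll ends a₂ {a₁} ∩ (connEvent ends a₂ o ∩ connEvent ends a₂ b)))
    (prob p (PDEvent ends a₁ a₂ u)) (Do p ends o a₁ a₂ u) (EQb3 p ends a₁ a₂ u b)
    (EQb3o p ends o a₁ a₂ u b) (EQ3 p ends a₁ a₂ u) (EQ3o p ends o a₁ a₂ u)
    (PDb p ends a₁ a₂ u b) (PDbo p ends o a₁ a₂ u b)
  have hQQ : 0 < prob p (avoidAll ends a₂ {a₁}) * prob p (avoidAll ends a₂ {a₁}) := mul_pos hQ hQ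
  constructor
  · intro h
    have h0 := mul_nonneg hD.le (sub_nonneg.2 h)
    rw [key] at h0
    exact (mul_nonneg_iff_of_pos_left hQQ).1 h0
  · intro h
    have h0 := mul_nonneg hQQ.le h
    rw [← key] at h0
    exact sub_nonneg.1 ((mul_nonneg_iff_of_pos_left hD).1 h0)

omit [Fintype V] [DecidableEq V] in
/-- **`Sub1 ∧ Sub2` at a pendant edge from (HCOV⁺) at the identified instance and (HCOV) at the open
pin** — no positive-association hypothesis. -/
theorem sub_of_pendant_of_hcovPlus
    (hK : ∀ e ∈ fracEdges p, TouchesReach p ends a₃ e → e = f)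
    (hf : ends f = s(z, u)) (hz : z ∈ pinnedReach p ends a₃) (hu : u ∉ pinnedReach p ends a₃)
    (hf1 : p f ≠ 1) (h1 : a₁ ∉ pinnedReach p ends a₃) (h2 : a₂ ∉ pinnedReach p ends a₃)
    (ho : o ∉ pinnedReach p ends a₃) (hb : b ∉ pinnedReach p ends a₃)
    (hD : 0 < prob p (PDEvent ends a₁ a₂ u)) (hQ : 0 < prob p (avoidAll ends a₂ {a₁}))
    (h₁ : HCov (Function.update p f 1) ends o a₁ a₂ a₃ b)
    (hplus : HCovPlus p ends o a₁ a₂ u b) :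
    Sub1 p ends o a₁ a₂ a₃ b f ∧ Sub2 p ends o a₁ a₂ a₃ b f := by
  refine ⟨(sub1_pendant_iff_hcovPlus hK hf hz hu hf1 h1 h2 ho hb hD hQ).2 hplus, ?_⟩
  obtain ⟨hQ0, hD0, hDo0, hEQbo0, hEQb3_0, hEQb3o0, hEQo0, hEQ3_0, hEQ3o0, hPDb0, hPDbo0, hgap0⟩ :=
    pins_zero_cluster p hK hf hz hu hf1 h1 h2 ho hb
  obtain ⟨hQ1, hD1, hDo1, hEQbo1, hEQb3_1, hEQb3o1, hEQo1, hEQ3_1, hEQ3o1, hPDb1, hPDbo1, hgap1⟩ :=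
    pins_one_cluster p hK hf hz hu hf1 h1 h2 ho hb
  unfold HCov at h₁
  rw [Gc_eq_GcPoly] at h₁
  rw [hQ1, hD1, hDo1, hEQbo1, hEQb3_1, hEQb3o1, hEQo1, hEQ3_1, hEQ3o1, hPDb1, hPDbo1, hgap1] at h₁
  unfold HCovPlus covU slackB at hplus
  rw [Gc_eq_GcPoly] at hplus
  unfold Sub2
  rw [Gc_eq_GcPoly]
  unfold B2
  rw [hQ0, hD0, hDo0, hEQbo0, hEQb3_0, hEQb3o0, hEQo0, hEQ3_0, hEQ3o0, hPDb0, hPDbo0, hgap0,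
    hQ1, hD1, hDo1, hEQbo1, hEQb3_1, hEQb3o1, hEQo1, hEQ3_1, hEQ3o1, hPDb1, hPDbo1, hgap1]
  have key := sub2Poly_pendant' (prob p (avoidAll ends a₂ {a₁})) (gap p ends a₁ a₂ b)
    (EQbo p ends o a₁ a₂ b) (EQo p ends o a₁ a₂)
    (prob p (avoidAll ends a₂ {a₁} ∩ connEvent ends a₁ o) +
      prob p (avoidAll ends a₂ {a₁} ∩ connEvent ends a₂ o))
    (prob p (avoidAll ends a₂ {a₁} ∩ connEvent ends a₁ b) +
      prob p (avoidAll ends a₂ {a₁} ∩ connEvent ends a₂ b))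
    (prob p (avoidAll ends a₂ {a₁} ∩ (connEvent ends a₁ o ∩ connEvent ends a₁ b)) +
      prob p (avoidAll ends a₂ {a₁} ∩ (connEvent ends a₂ o ∩ connEvent ends a₁ b)) +
      prob p (avoidAll ends a₂ {a₁} ∩ (connEvent ends a₁ o ∩ connEvent ends a₂ b)) +
      prob p (avoidAll ends a₂ {a₁} ∩ (connEvent ends a₂ o ∩ connEvent ends a₂ b)))
    (prob p (PDEvent ends a₁ a₂ u)) (Do p ends o a₁ a₂ u) (EQb3 p ends a₁ a₂ u b)
    (EQb3o p ends o a₁ a₂ u b) (EQ3 p ends a₁ a₂ u) (EQ3o p ends o a₁ a₂ u)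
    (PDb p ends a₁ a₂ u b) (PDbo p ends o a₁ a₂ u b)
  have hQQ : 0 ≤ prob p (avoidAll ends a₂ {a₁}) * prob p (avoidAll ends a₂ {a₁}) :=
    mul_nonneg hQ.le hQ.le
  have hr := add_nonneg (mul_nonneg (mul_nonneg hQQ hD.le) h₁) (mul_nonneg hQQ hplus)
  rw [← key] at hr
  exact sub_nonneg.1 ((mul_nonneg_iff_of_pos_left hD).1 hr)

end Pendant

end CPolarSubPlus

end Summit.Ventures.PercRepro2
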